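import Literature.Computability.Complexity.SymmetricThresholdProgramsSymmetry
import Literature.Computability.Complexity.SymmetricThresholdProgramsLexMin
import Literature.Computability.Complexity.SymmetricThresholdProgramsReadout
import Summits.PneNP.PneNP.Theorems.SymmetryBudgetNoHiddenOrderOfGraphCanonisation

/-!
# `NoHiddenOrder` (stmt-PneNP-14781): the lex-min socket — definitions

Route `PneNP/SymmetryBudget`.  The positive landing pad `noHiddenOrder_of_entrywiseCanoniser`
(`SymmetryBudgetNoHiddenOrderOfGraphCanonisation.lean`) asks for `Bud(m,⌊log₂ m⌋)`-symmetric
threshold circuits, one per output entry, computing a matrix whose graph is the graph of a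
`Bud`-relabelling of the input.  Every construction on file (certified labels over the
Corneil–Goldberg tree, PROOF-NoHiddenOrder / PER-PATH memos on the item) has the same top layer:
gate groups indexed by LABELS, each producing a flag ("my label decodes and my run succeeds") and a
candidate relabelled matrix, and the output is the lexicographically least flagged candidate.
With the symmetric-threshold-PROGRAM calculus (`Literature/…/SymmetricThresholdPrograms*.lean`)
that top layer and the whole circuit-level bookkeeping are discharged here once and for all:

`noHiddenOrder_of_lexMinProgram`: `NoHiddenOrder` follows as soon as, for one polynomial `q` and
all large `m`, there is a `LexMinProgram m` of size `2·|Λ|+2 ≤ q m`, i.e.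
* a program `P : SymProg (Fin m × Fin m) Λ` with a lex-min gadget `G : P.LexMin L (m·m)` on top;
* SYMMETRY DATA: for every `ρ` in the budget a symmetry `θ ρ` of `P` over the diagonal input map
  of `ρ` (`SymProg.IsSym`) fixing the output gates `G.out p`;
* SOUNDNESS: every flagged label's value vector is the matrix `x ∘ (ρ × ρ)` of some `ρ` in the
  budget (read through `finProdFinEquiv`);
* COMPLETENESS: on every input some label is flagged.
No statement about wires, gate lists, topological order, automorphisms of circuits or invariance
remains: symmetry of the compiled circuit is `SymProg.hasSymCircuit_gate`, its semantics
`SymProg.LexMin.exists_sem_out_eq`.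

`noHiddenOrder_of_lexMinReadoutProgram`: the same with SOUNDNESS discharged by the readout gadget
(`SymmetricThresholdProgramsReadout.lean`): the value wires are the entries of the readout of
POSITION wires, and it only remains that a flagged label's position wires encode a permutation
fixing the ordered part (`SymProg.Readout.Encodes`) — the natural output of a discretising run.
This file: the STRUCTURES `LexMinProgram m`, `LexMinReadoutProgram m` (what a construction must provide), the
computed matrix `LexMinProgram.CF`, the window `windowSet m`, and the forgetful map
`LexMinReadoutProgram.toLexMinProgram` (soundness from the readout). The socket theorems are in
`SymmetryBudgetNoHiddenOrderLexMinSocket.lean`. Sorry-free; supports stmt-PneNP-14781, does not close it.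
-/

set_option linter.dupNamespace false -- `Summit.PneNP.PneNP.…` (D-0017 single-conjunct layout)

namespace Summit.PneNP.PneNP.Theorems

open scoped Classical
open Filter Literature.Computability.Complexity Literature.Computability.Complexity.SymProg
open Summit.PneNP.PneNP.Theses.SymmetryBudget

/-- **What a symmetric threshold program must provide to be a window canoniser at size `m`.**
A program over the matrix inputs with a lex-min gadget over `m·m` output positions on top,
symmetry data for the budget `Bud(m,⌊log₂ m⌋)` fixing the outputs, soundness of flagged labels
(their value vector is a `Bud`-relabelling of the input matrix) and completeness (some label is
flagged). [folklore] -/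
structure LexMinProgram (m : ℕ) where
  /-- the logical gates -/
  Λ : Type
  /-- finitely many gates -/
  [instFintype : Fintype Λ]
  /-- with decidable equality -/
  [instDecEq : DecidableEq Λ]
  /-- the program -/
  P : SymProg (Fin m × Fin m) Λ
  /-- the labels of the top layer -/
  L : Type
  /-- finitely many labels -/
  [instFintypeL : Fintype L]
  /-- the lex-min gadget on top, over the `m·m` output positions -/
  G : P.LexMin L (m * m)
  /-- symmetry data: the relabelling of gates over each permutation of the budget -/
  θ : Equiv.Perm (Fin m) → Λ ≃ Λ
  /-- … is a symmetry of the program over the diagonal input map -/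
  isSym : ∀ ρ ∈ pointStabiliserBudget m (Nat.log 2 m), P.IsSym (SymProg.diagMap ρ) (θ ρ)
  /-- … fixing the output gates -/
  out_fixed : ∀ ρ ∈ pointStabiliserBudget m (Nat.log 2 m), ∀ p, θ ρ (G.out p) = G.out p
  /-- soundness: a flagged label carries the matrix of a `Bud`-relabelling of the input -/
  sound : ∀ x ℓ, G.Ok x ℓ → ∃ ρ ∈ pointStabiliserBudget m (Nat.log 2 m),
    ∀ q₀ : Fin m × Fin m, G.V x ℓ (finProdFinEquiv q₀) = x (ρ q₀.1, ρ q₀.2)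
  /-- completeness: some label is flagged -/
  complete : ∀ x, ∃ ℓ, G.Ok x ℓ

namespace LexMinProgram

variable {m : ℕ} (D : LexMinProgram m)

attribute [instance] LexMinProgram.instFintype LexMinProgram.instDecEq LexMinProgram.instFintypeL

/-- The matrix computed by the program: entry `q₀` is the output gate at position
`finProdFinEquiv q₀`. [folklore] -/
def CF (x : Fin m × Fin m → Bool) (q₀ : Fin m × Fin m) : Bool :=
  D.P.sem x (D.G.out (finProdFinEquiv q₀))

end LexMinProgram

/-! ### Soundness from the readout gadget -/

/-- The window of size `⌊log₂ m⌋` as a finite set of indices: those NOT fixed by the budget. [folklore] -/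
def windowSet (m : ℕ) : Finset (Fin m) := Finset.univ.filter fun i => ¬ ((i : ℕ) + Nat.log 2 m < m)

/-- Membership in the window. [folklore] -/
theorem mem_windowSet_iff {m : ℕ} (i : Fin m) : i ∈ windowSet m ↔ ¬ ((i : ℕ) + Nat.log 2 m < m) := by
  simp [windowSet]

/-- A permutation fixing every index outside the window lies in the budget. [folklore] -/
theorem mem_budget_of_fix {m : ℕ} {π : Equiv.Perm (Fin m)} (h : ∀ i, i ∉ windowSet m → π i = i) :
    π ∈ pointStabiliserBudget m (Nat.log 2 m) := by
  rw [mem_pointStabiliserBudget_iff]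
  intro i hi
  exact h i (by rw [mem_windowSet_iff]; exact fun h' => h' hi)

/-- **A lex-min program whose values are READ OUT from position wires.** As `LexMinProgram`, but
instead of soundness of the value vectors: a readout gadget over the window whose entries are the
value wires, and the requirement that a flagged label's position wires encode a permutation that is
the identity on the ordered part. [folklore] -/
structure LexMinReadoutProgram (m : ℕ) where
  /-- the logical gates -/
  Λ : Type
  /-- finitely many gates -/
  [instFintype : Fintype Λ]
  /-- with decidable equality -/
  [instDecEq : DecidableEq Λ]
  /-- the program -/
  P : SymProg (Fin m × Fin m) Λ
  /-- the labels of the top layer -/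
  L : Type
  /-- finitely many labels -/
  [instFintypeL : Fintype L]
  /-- the lex-min gadget on top, over the `m·m` output positions -/
  G : P.LexMin L (m * m)
  /-- the readout gadget over the window -/
  R : P.Readout L (windowSet m)
  /-- the value wires of the lex-min gadget are the entries of the readout -/
  val_eq : ∀ ℓ (q₀ : Fin m × Fin m), G.val ℓ (finProdFinEquiv q₀) = Sum.inr (R.entry ℓ q₀.1 q₀.2)
  /-- symmetry data: the relabelling of gates over each permutation of the budget -/
  θ : Equiv.Perm (Fin m) → Λ ≃ Λ
  /-- … is a symmetry of the program over the diagonal input map -/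
  isSym : ∀ ρ ∈ pointStabiliserBudget m (Nat.log 2 m), P.IsSym (SymProg.diagMap ρ) (θ ρ)
  /-- … fixing the output gates -/
  out_fixed : ∀ ρ ∈ pointStabiliserBudget m (Nat.log 2 m), ∀ p, θ ρ (G.out p) = G.out p
  /-- a flagged label's position wires encode a permutation fixing the ordered part -/
  encodes : ∀ x ℓ, G.Ok x ℓ → ∃ π : Equiv.Perm (Fin m), R.Encodes x ℓ π
  /-- completeness: some label is flagged -/
  complete : ∀ x, ∃ ℓ, G.Ok x ℓ

namespace LexMinReadoutProgram

variable {m : ℕ} (D : LexMinReadoutProgram m)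

attribute [instance] LexMinReadoutProgram.instFintype LexMinReadoutProgram.instDecEq
  LexMinReadoutProgram.instFintypeL

/-- **Soundness from the readout**: forget the readout, keep its consequence. [folklore] -/
def toLexMinProgram : LexMinProgram m where
  Λ := D.Λ
  P := D.P
  L := D.L
  G := D.G
  θ := D.θ
  isSym := D.isSym
  out_fixed := D.out_fixed
  sound x ℓ hℓ := by
    obtain ⟨π, hπ⟩ := D.encodes x ℓ hℓ
    refine ⟨π.symm, mem_budget_of_fix fun i hi => hπ.symm_fix i hi, fun q₀ => ?_⟩
    show wval x (D.P.sem x) (D.G.val ℓ (finProdFinEquiv q₀)) = _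
    rw [D.val_eq, wval_inr, D.R.sem_entry_of_encodes x hπ]
  complete := D.complete

end LexMinReadoutProgram

end Summit.PneNP.PneNP.Theorems
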